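import Literature.MathematicalPhysics.QuantumLattice.BallSpecification
import Mathlib.MeasureTheory.Measure.WithDensity
import Mathlib.MeasureTheory.Integral.Lebesgue.Add
import Mathlib.Analysis.InnerProductSpace.PiL2
import HarnessLib

/-!
# Exterior tilts of a ball-Gibbs law are Gibbs: the version-free competitors hidden in stub S2'
# of crux `BallSpecifiedInversionUpgrade` (stmt-CriticalPhenomena-11248)

Route `route-CriticalPhenomena-BallSpecification`, sub-problem `Ising3DConformalLimit`, line `birth`
(skeleton r3), helper file landed `--supports stmt-CriticalPhenomena-11248` by lead c5.  Theorem-only,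
model-free measure theory on `Ω = FieldConfig E`.

## Content

Let `γ` be ball kernels and `μ` a law with the DLR equations on the balls inside `U`
(`IsGibbsFor γ μ U`), the kernels being exterior-measurable.  If `h : Ω → ℝ≥0∞` has `∫ h dμ = 1` and is
measurable with respect to the EXTERIOR σ-algebra `extEvents (closedBall c r)ᶜ` of every ball
`closedBall c r ⊆ U' ⊆ U`, then the tilted law `h · μ` again satisfies the DLR equations for the SAME
kernels on the balls inside `U'` (`isGibbsFor_withDensity_of_exterior_measurable`).  The mechanism is
the functional form of the DLR equation (`setLIntegral_eq_lintegral_mul_kernel`: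
`∫_A F dμ = ∫ F · γ(·, A) dμ` for exterior-measurable `F ≥ 0`), a two-line consequence of the
uniqueness of measures on the exterior σ-algebra (`Measure.trim`).

For the punctured regions of the crux this produces, from ANY witness `γ'` of stub
`stub_centreBlindExactPuncturedVersion` (S2') and any density `h` measurable with respect to
`extEvents (R_s)ᶜ` for every annulus `R_s = {s < ‖x‖ < s⁻¹}` — in particular any `h` measurable
with respect to the POINT GERM `⨅ ε > 0, extEvents (ball 0 ε)` at the puncture or to the TAIL
`⨅ R > 0, extEvents (closedBall 0 R)ᶜ` (`pointGerm_le_extEvents_annulus_compl`,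
`tail_le_extEvents_annulus_compl`) — a constant family `ν_s := h · μ` satisfying the first two
hypothesis groups of S2''s punctured-uniqueness clause (PU'): consistency, probability, and the
interior DLR equations of `γ'` on every closed ball inside every `R_s`
(`germTilt_isCompetitor`).  These competitors are DLR for EVERY version of the kernels of `μ`
(they are defined from `μ` and `h` alone), so no choice of the existential witness `γ'` in S2' can
exclude them: S2' — whatever its witness — implies the VERSION-FREE property of `μ` alone

  (GT')  every point-germ/tail density `h ≥ 0`, `∫ h dμ = 1`, in the exact low-order class
         (`∫ h · ω f dμ = 0`, `∫ h · (ω f)² dμ = ∫ (ω f)² dμ` for `f` compactly supported off `0`)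
         reproduces ALL punctured moments of `μ`,

a quasi-triviality of the point germ of `μ` at `0` and of its tail (trivial σ-algebras make (GT')
empty; it is implied by, and is the moment shadow of, Kolmogorov regularity of the ball filtration
under the dilation flow — "the radial transfer operator has a unique ground state").  (GT') is not a
consequence of the crux antecedent `H` (no clause of `H` speaks about non-linear germ functionals),
it is a statement about `μ` only (no kernels, no inversion), and it is therefore separately fileable;
see the lead-c5 analysis `Cruxes/BallSpecifiedInversionUpgrade/NOTES-c5.md`.

References: H.-O. Georgii, *Gibbs Measures and Phase Transitions* (2011), Def. 1.23, Remark 1.24 and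
§7.1 (tilting by tail-measurable densities preserves the DLR equations; extremality ⇔ tail
triviality, Thm. 7.7); H. Föllmer, *Random fields and diffusion processes*, Saint-Flour XV–XVII
(1988), §1 (1.19)–(1.21); M. Röckner, Comm. Math. Phys. 106 (1986) §1.
-/

noncomputable section

namespace Summit.CriticalPhenomena.Ising3DConformalLimit.BallSpecificationBallSpecifiedInversionUpgrade

open MeasureTheory Metric Set
open Literature.MathematicalPhysics.QuantumLattice
open scoped ENNReal SchwartzMap

section General

variable {E : Type*} [NormedAddCommGroup E] [NormedSpace ℝ E]

/-- **Functional form of the DLR equation.**  If `μ` satisfies the DLR equations for `γ` on the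
balls inside `U` and `η ↦ γ c r η A` is exterior-measurable, then for every exterior-measurable
`F ≥ 0`: `∫_A F dμ = ∫ F · γ(·, A) dμ` (the set form is `F = 1_B`; the two sides are the integrals of
`F` against two measures that agree on the exterior σ-algebra). [cite: Georgii2011, Def. 1.23 and Remark 1.24] -/
theorem setLIntegral_eq_lintegral_mul_kernel
    {γ : E → ℝ → FieldConfig E → Measure (FieldConfig E)} {μ : Measure (FieldConfig E)}
    {U : Set E} (h : IsGibbsFor γ μ U) {c : E} {r : ℝ} (hr : 0 < r) (hsub : closedBall c r ⊆ U)
    {A : Set (FieldConfig E)} (hA : MeasurableSet A)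
    (hγ : Measurable[extEvents (closedBall c r)ᶜ] fun η => γ c r η A)
    {F : FieldConfig E → ℝ≥0∞} (hF : Measurable[extEvents (closedBall c r)ᶜ] F) :
    ∫⁻ ω in A, F ω ∂μ = ∫⁻ η, F η * γ c r η A ∂μ := by
  have hm : extEvents (E := E) (closedBall c r)ᶜ ≤
      (FieldConfig.instMeasurableSpace : MeasurableSpace (FieldConfig E)) := extEvents_le _
  have key : (μ.restrict A).trim hm = (μ.withDensity fun η => γ c r η A).trim hm := by
    refine @Measure.ext _ (extEvents (closedBall c r)ᶜ) _ _ fun B hB => ?_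
    rw [trim_measurableSet_eq hm hB, trim_measurableSet_eq hm hB,
      Measure.restrict_apply (hm B hB), Set.inter_comm, withDensity_apply _ (hm B hB)]
    exact h.2 c r hr hsub A hA B hB
  calc ∫⁻ ω in A, F ω ∂μ = ∫⁻ ω, F ω ∂(μ.restrict A).trim hm := (lintegral_trim hm hF).symm
    _ = ∫⁻ ω, F ω ∂(μ.withDensity fun η => γ c r η A).trim hm := by rw [key]
    _ = ∫⁻ ω, F ω ∂(μ.withDensity fun η => γ c r η A) := lintegral_trim hm hF
    _ = ∫⁻ η, F η * γ c r η A ∂μ := by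
        rw [lintegral_withDensity_eq_lintegral_mul _ (hγ.mono hm le_rfl) (hF.mono hm le_rfl)]
        simp only [Pi.mul_apply, mul_comm]

/-- **Exterior tilts of a ball-Gibbs law are Gibbs for the same kernels.**  If `μ` is DLR for `γ` on
the balls inside `U` (kernels exterior-measurable on Borel events) and `h ≥ 0`, `∫ h dμ = 1`, is
measurable with respect to the exterior σ-algebra of every closed ball inside `U' ⊆ U`, then `h · μ`
is DLR for `γ` on the balls inside `U'`.  (Lattice analogue: tilting a Gibbs measure by a
tail-measurable density gives a Gibbs measure for the same specification, Georgii 2011 §7.1.) [cite: Georgii2011, §7.1, Thm. 7.7] -/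
theorem isGibbsFor_withDensity_of_exterior_measurable
    {γ : E → ℝ → FieldConfig E → Measure (FieldConfig E)} {μ : Measure (FieldConfig E)}
    {U U' : Set E} (h : IsGibbsFor γ μ U) (hU : U' ⊆ U)
    (hγ : ∀ c r, 0 < r → closedBall c r ⊆ U' → ∀ A : Set (FieldConfig E), MeasurableSet A →
      Measurable[extEvents (closedBall c r)ᶜ] fun η => γ c r η A)
    {hd : FieldConfig E → ℝ≥0∞} (hdm : Measurable hd)
    (hde : ∀ c r, 0 < r → closedBall c r ⊆ U' → Measurable[extEvents (closedBall c r)ᶜ] hd)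
    (hone : ∫⁻ ω, hd ω ∂μ = 1) :
    IsGibbsFor γ (μ.withDensity hd) U' := by
  refine ⟨⟨by rw [withDensity_apply _ MeasurableSet.univ, Measure.restrict_univ, hone]⟩, ?_⟩
  intro c r hr hsub A hA B hB
  have hm : extEvents (E := E) (closedBall c r)ᶜ ≤
      (FieldConfig.instMeasurableSpace : MeasurableSpace (FieldConfig E)) := extEvents_le _
  have hBm : MeasurableSet B := hm B hB
  have hγB : Measurable fun η => γ c r η A := (hγ c r hr hsub A hA).mono hm le_rfl
  rw [withDensity_apply _ (hA.inter hBm),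
    setLIntegral_withDensity_eq_setLIntegral_mul _ hdm hγB hBm]
  have h1 : ∫⁻ ω in A ∩ B, hd ω ∂μ = ∫⁻ ω in A, B.indicator hd ω ∂μ := by
    rw [lintegral_indicator hBm, Measure.restrict_restrict hBm, Set.inter_comm]
  have h2 : ∫⁻ x in B, (hd * fun η => γ c r η A) x ∂μ =
      ∫⁻ η, B.indicator hd η * γ c r η A ∂μ := by
    rw [← lintegral_indicator hBm]
    refine lintegral_congr fun η => ?_
    by_cases hη : η ∈ B
    · simp only [indicator_of_mem hη, Pi.mul_apply]
    · simp only [indicator_of_notMem hη, zero_mul]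
  rw [h1, h2]
  exact setLIntegral_eq_lintegral_mul_kernel h hr (hsub.trans hU) hA (hγ c r hr hsub A hA)
    ((hde c r hr hsub).indicator hB)

end General

/-! ### The punctured regions of the crux: point-germ / tail tilts are (PU')-competitors -/

/-- The point germ at the puncture sees only the complement of every annulus `R_s`:
`⨅ ε > 0, extEvents (ball 0 ε) ≤ extEvents (R_s)ᶜ` for `0 < s`. [folklore] -/
theorem pointGerm_le_extEvents_annulus_compl {s : ℝ} (hs : 0 < s) :
    (⨅ (ε : ℝ) (_ : 0 < ε), extEvents (ball (0 : EuclideanSpace ℝ (Fin 3)) ε)) ≤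
      extEvents {x : EuclideanSpace ℝ (Fin 3) | s < ‖x‖ ∧ ‖x‖ < s⁻¹}ᶜ := by
  refine (iInf₂_le s hs).trans (extEvents_mono fun x hx => ?_)
  simp only [mem_ball, dist_zero_right] at hx
  simp only [mem_compl_iff, mem_setOf_eq, not_and, not_lt]
  exact fun h => absurd h (not_lt.2 hx.le)

/-- The tail sees only the complement of every annulus `R_s`:
`⨅ R > 0, extEvents (closedBall 0 R)ᶜ ≤ extEvents (R_s)ᶜ` for `0 < s`. [folklore] -/
theorem tail_le_extEvents_annulus_compl {s : ℝ} (hs : 0 < s) :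
    (⨅ (R : ℝ) (_ : 0 < R), extEvents (closedBall (0 : EuclideanSpace ℝ (Fin 3)) R)ᶜ) ≤
      extEvents {x : EuclideanSpace ℝ (Fin 3) | s < ‖x‖ ∧ ‖x‖ < s⁻¹}ᶜ := by
  refine (iInf₂_le s⁻¹ (inv_pos.2 hs)).trans (extEvents_mono fun x hx => ?_)
  simp only [mem_compl_iff, mem_closedBall, dist_zero_right, not_le] at hx
  simp only [mem_compl_iff, mem_setOf_eq, not_and, not_lt]
  exact fun _ => hx.le

/-- **Point-germ / tail tilts of `μ` are competitors in S2''s punctured-uniqueness clause, for every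
version of the kernels.**  Let `γ'` be kernels that are exterior-measurable on Borel events and DLR for
`μ` on all balls (`IsGibbsFor γ' μ univ`, two of the five kernel clauses of the witness of
`stub_centreBlindExactPuncturedVersion`), and let `h ≥ 0` be Borel with `∫ h dμ = 1` and measurable with
respect to `extEvents (R_s)ᶜ` for every `0 < s < 1` (e.g. point-germ- or tail-measurable, by the two
lemmas above).  Then the constant family `ν_s := h · μ` satisfies the consistency hypothesis and the
probability + interior-DLR hypothesis of (PU') verbatim.  Consequently S2' (any witness) implies that every
such `h` lying in the exact low-order class of `μ` reproduces all punctured moments of `μ` — a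
version-free quasi-triviality of the point germ and the tail of `μ` ((GT') of the module docstring). [cite: Georgii2011, §7.1, Thm. 7.7] -/
theorem germTilt_isCompetitor :
    ∀ (μ : MeasureTheory.Measure (Literature.MathematicalPhysics.QuantumLattice.FieldConfig (EuclideanSpace ℝ (Fin 3)))) (γ' : EuclideanSpace ℝ (Fin 3) → ℝ → Literature.MathematicalPhysics.QuantumLattice.FieldConfig (EuclideanSpace ℝ (Fin 3)) → MeasureTheory.Measure (Literature.MathematicalPhysics.QuantumLattice.FieldConfig (EuclideanSpace ℝ (Fin 3)))) (hd : Literature.MathematicalPhysics.QuantumLattice.FieldConfig (EuclideanSpace ℝ (Fin 3)) → ENNReal), (∀ (c : EuclideanSpace ℝ (Fin 3)) (r : ℝ), 0 < r → ∀ A : Set (Literature.MathematicalPhysics.QuantumLattice.FieldConfig (EuclideanSpace ℝ (Fin 3))), MeasurableSet A → Measurable[Literature.MathematicalPhysics.QuantumLattice.extEvents (Metric.closedBall c r)ᶜ] (fun η => γ' c r η A)) → Literature.MathematicalPhysics.QuantumLattice.IsGibbsFor γ' μ Set.univ → Measurable hd → (∀ s : ℝ, 0 < s → s < 1 → Measurable[Literature.MathematicalPhysics.QuantumLattice.extEvents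 ({x : EuclideanSpace ℝ (Fin 3) | s < ‖x‖ ∧ ‖x‖ < s⁻¹})ᶜ] hd) → ∫⁻ ω, hd ω ∂μ = 1 → (∀ s s' : ℝ, 0 < s → s ≤ s' → s' < 1 → ∀ A, MeasurableSet[Literature.MathematicalPhysics.QuantumLattice.extEvents {x : EuclideanSpace ℝ (Fin 3) | s' < ‖x‖ ∧ ‖x‖ < s'⁻¹}] A → (fun _ : ℝ => μ.withDensity hd) s A = (fun _ : ℝ => μ.withDensity hd) s' A) ∧ (∀ s : ℝ, 0 < s → s < 1 → (MeasureTheory.IsProbabilityMeasure ((fun _ : ℝ => μ.withDensity hd) s) ∧ ∀ (c : EuclideanSpace ℝ (Fin 3)) (r : ℝ), 0 < r → Metric.closedBall c r ⊆ {x : EuclideanSpace ℝ (Fin 3) | s < ‖x‖ ∧ ‖x‖ < s⁻¹} → ∀ A, MeasurableSet[Literature.MathematicalPhysics.QuantumLattice.extEvents (Metric.ball c r)] A → ∀ B, MeasurableSet[Literature.MathematicalPhysics.QuantumLattice.extEvents (Metric.closedBall c r)ᶜ] B → (fun _ : ℝ => μ.withDensity hd) s (A ∩ B) = ∫⁻ η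 in B, γ' c r η A ∂((fun _ : ℝ => μ.withDensity hd) s))) := by
  intro μ γ' hd k2 k5 hdm hde hone
  refine ⟨fun _ _ _ _ _ _ _ => rfl, fun s hs hs1 => ?_⟩
  have hG : IsGibbsFor γ' (μ.withDensity hd) {x : EuclideanSpace ℝ (Fin 3) | s < ‖x‖ ∧ ‖x‖ < s⁻¹} :=
    isGibbsFor_withDensity_of_exterior_measurable k5 (subset_univ _)
      (fun c r hr _ A hA => k2 c r hr A hA) hdm
      (fun c r _ hsub => (hde s hs hs1).mono (extEvents_mono (compl_subset_compl.2 hsub)) le_rfl)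
      hone
  exact ⟨hG.1, fun c r hr hsub A hA B hB => hG.2 c r hr hsub A (extEvents_le _ A hA) B hB⟩

/-- **Consistent shell tilts (boundary states at `0` / `∞`) are competitors too, for every version.**
The `s`-dependent form of `germTilt_isCompetitor`: if `g s ≥ 0`, `∫ g s dμ = 1`, is measurable with
respect to `extEvents (R_s)ᶜ` (the field in the hole `‖x‖ ≤ s` and beyond `‖x‖ ≥ s⁻¹`, boundary
spheres included) for each `0 < s < 1`, then every `ν_s := g s · μ` is a probability law satisfying the
interior DLR equations of `γ'` on the closed balls inside `R_s` — whatever the version `γ'` of the kernels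
of `μ` (only exterior measurability and `IsGibbsFor γ' μ univ` are used).  The remaining hypothesis of
(PU') on such a family, consistency on `extEvents R_{s'}` (`E_μ[g s · X] = E_μ[g s' · X]` for
`X ∈ L^∞(extEvents R_{s'})`, `s ≤ s'`), is the defining property of a BOUNDARY-STATE family (a state of
the radial transfer dynamics entering at the puncture and at infinity; uniformly integrable families are
the point-germ/tail tilts of `germTilt_isCompetitor`, non-uniformly-integrable ones are insertion
states).  Hence S2' with ANY witness also implies the version-free, `μ`-only statement (BS'): every
consistent boundary-state family in the exact low-order class of `μ` has the punctured moments of `μ`. [cite: Georgii2011, §7.1, Thm. 7.7] -/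
theorem shellTilt_isCompetitor :
    ∀ (μ : MeasureTheory.Measure (Literature.MathematicalPhysics.QuantumLattice.FieldConfig (EuclideanSpace ℝ (Fin 3)))) (γ' : EuclideanSpace ℝ (Fin 3) → ℝ → Literature.MathematicalPhysics.QuantumLattice.FieldConfig (EuclideanSpace ℝ (Fin 3)) → MeasureTheory.Measure (Literature.MathematicalPhysics.QuantumLattice.FieldConfig (EuclideanSpace ℝ (Fin 3)))) (g : ℝ → Literature.MathematicalPhysics.QuantumLattice.FieldConfig (EuclideanSpace ℝ (Fin 3)) → ENNReal), (∀ (c : EuclideanSpace ℝ (Fin 3)) (r : ℝ), 0 < r → ∀ A : Set (Literature.MathematicalPhysics.QuantumLattice.FieldConfig (EuclideanSpace ℝ (Fin 3))), MeasurableSet A → Measurable[Literature.MathematicalPhysics.QuantumLattice.extEvents (Metric.closedBall c r)ᶜ] (fun η => γ' c r η A)) → Literature.MathematicalPhysics.QuantumLattice.IsGibbsFor γ' μ Set.univ → (∀ s : ℝ, 0 < s → s < 1 → Measurable (g s)) → (∀ s : ℝ, 0 < s → s < 1 → Measurable[Literature.MathematicalPhysics.QuantumLattice.extEvents ({x : EuclideanSpace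 ℝ (Fin 3) | s < ‖x‖ ∧ ‖x‖ < s⁻¹})ᶜ] (g s)) → (∀ s : ℝ, 0 < s → s < 1 → ∫⁻ ω, g s ω ∂μ = 1) → ∀ s : ℝ, 0 < s → s < 1 → (MeasureTheory.IsProbabilityMeasure (μ.withDensity (g s)) ∧ ∀ (c : EuclideanSpace ℝ (Fin 3)) (r : ℝ), 0 < r → Metric.closedBall c r ⊆ {x : EuclideanSpace ℝ (Fin 3) | s < ‖x‖ ∧ ‖x‖ < s⁻¹} → ∀ A, MeasurableSet[Literature.MathematicalPhysics.QuantumLattice.extEvents (Metric.ball c r)] A → ∀ B, MeasurableSet[Literature.MathematicalPhysics.QuantumLattice.extEvents (Metric.closedBall c r)ᶜ] B → (μ.withDensity (g s)) (A ∩ B) = ∫⁻ η in B, γ' c r η A ∂(μ.withDensity (g s))) := by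
  intro μ γ' g k2 k5 hgm hge hone s hs hs1
  have hG : IsGibbsFor γ' (μ.withDensity (g s)) {x : EuclideanSpace ℝ (Fin 3) | s < ‖x‖ ∧ ‖x‖ < s⁻¹} :=
    isGibbsFor_withDensity_of_exterior_measurable k5 (subset_univ _)
      (fun c r hr _ A hA => k2 c r hr A hA) (hgm s hs hs1)
      (fun c r _ hsub => (hge s hs hs1).mono (extEvents_mono (compl_subset_compl.2 hsub)) le_rfl)
      (hone s hs hs1)
  exact ⟨hG.1, fun c r hr hsub A hA B hB => hG.2 c r hr hsub A (extEvents_le _ A hA) B hB⟩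

end Summit.CriticalPhenomena.Ising3DConformalLimit.BallSpecificationBallSpecifiedInversionUpgrade

end
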